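import Summits.PneNP.PneNP.Theorems.ChebyshevTracialDesignLowDegreePricing
import Summits.PneNP.PneNP.Theorems.ChebyshevTracialDesignHighPartTail
import HarnessLib

/-!
# Cell pnp-psdrank, route `ChebyshevTracialDesign`: the r = 1 DEGREE-TRUNCATION THEOREM — the design value of every rectangle is
# minus the virtual (Grigoriev) value of the low-degree part of `1_X`, up to a spectrally small tail

Harmonic backbone of the crux `TracialDecayExp20` (stmt-PneNP-19878), brick 16 = bricks 14 + 15 assembled (MEMO-8 §4). Let `(n,t,T,D,B,C,w)`
be an exact design (`IsExactDesign`), `X` a family of `t`-cuts with harmonic layer decomposition `1_X = Σ_j (Wᵀ)^{t−j} p_j` on the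
`t`-sets (lit `exists_ladder_decomposition`; any such `p`), `q = Σ_{j ≤ D} (t−j)!·p_j` the coefficient vector of its low part
(`f_{≤D} = zeta q`, lit `lowPart_apply_eq_zeta`), and `Y` ANY set of perfect matchings. If `Λ_c ≥ 0` bounds the ladder eigenvalues of the
level-`c` Gram class function `κ_c` on the layers `D < j ≤ t` for every `c ∈ C` (brick 13 supplies such `Λ_c` for every level), then

  `| Σ_{U∈X} Σ_{M∈Y} W(U,M) + (1/|PM_n|)·Σ_{M∈Y} Ẽ_M[f_{≤D}] | ≤ Σ_{c∈C} (|w_c|/|Q_c|)·√(Λ_c·|Y|·|X|)`     (`rectangle_value_truncation`)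

with `Ẽ_M[zeta q] = Σ_{|A| ≤ D} q_A·knapsackMoment(|M|, t/2, |M[A]|)` Grigoriev's knapsack pseudo-expectation around `M` (bricks G/H of the junta
files). So the classical (`r = 1`) shadow of the crux — `Σ_{X×Y} W ≤ e^{−a·dq n}` for all (tight-free) rectangles — is EQUIVALENT, up to the
tail, to AVERAGE VIRTUAL POSITIVITY of truncated indicators: `Σ_{M∈Y} Ẽ_M[(1_X)_{≤D}] ≥ −(small)·|PM|`. This is the kernel form of the
route's two-layer plan (ATT ⇒ VIRT) at `r = 1`, with (ATT) discharged by bricks 12–13. [cite: Rothvoss2017, §2 (PDF p. 6)]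
[cite: Grigoriev2001, Lemma 1.4 (PDF p. 8)] [cite: BrouwerHaemers2012, Prop. 4.3.2 (PDF p. 83)]
Stature: support/instrument. WHAT THIS IS NOT: not virtual positivity itself, not the r = 1 rung, nothing on psd rank, no P-vs-NP content.
Supports stmt-PneNP-19878.
-/

set_option linter.dupNamespace false -- `Summit.PneNP.PneNP.…`: summit = sub-problem (D-0017)

noncomputable section

namespace Summit.PneNP.PneNP.Theorems.ChebyshevTracialDesignRectangleTruncation

open Finset Literature.Barriers.PneNP Literature.Combinatorics.Optimization Literature.Computability.Complexity
open Literature.Combinatorics.AssociationSchemes Literature.Combinatorics.AssociationSchemes.JohnsonHarmonics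
open Literature.Combinatorics.AssociationSchemes.JohnsonSpectrum
open Summit.PneNP.PneNP.Theorems.ChebyshevTracialDesignLowDegreePricing
open Summit.PneNP.PneNP.Theorems.ChebyshevTracialDesignHighPartTail

variable {n : ℕ}

/-- **The r = 1 degree-truncation theorem.** For an exact design `(n,t,T,D,B,C,w)`, a family `X` of `t`-subsets with a harmonic layer
decomposition `p` (`1[U ∈ X] = (Σ_{j ≤ t} (Wᵀ)^{t−j} p_j)(U)` on the `t`-sets), any set `Y` of perfect matchings, and bounds `Λ_c ≥ 0` on
the ladder eigenvalues `kernelEigen n t j κ_c`, `D < j ≤ t`, of the level Gram class functions `κ_c` (`c ∈ C`):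
`|Σ_U Σ_{M∈Y} levelWeight(U,M)·1_X(U) + (1/|PM|)·Σ_{M∈Y} Σ_{|A|≤D} q_A·knapsackMoment(|M|, t/2, |M[A]|)| ≤ Σ_{c∈C} |w_c|/|Q_c|·√(Λ_c·|Y|·|X|)`,
where `q = Σ_{j ≤ t} (t−j)!·[j ≤ D]·p_j` is the coefficient vector of the low-degree part of `1_X`.
[cite: Rothvoss2017, §2 (PDF p. 6)] [cite: Grigoriev2001, Lemma 1.4 (PDF p. 8)] -/
theorem rectangle_value_truncation {t T D : ℕ} {Bv : ℝ} {C : Finset ℕ} {w : ℕ → ℝ} (hdes : IsExactDesign n t T D Bv C w)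
    (X : Finset (Finset (Fin n))) (hX : X ⊆ univ.powersetCard t) (Y : Finset (PMatch n))
    (p : ℕ → Finset (Fin n) → ℝ) (hp : ∀ j, IsHarmonic j (p j))
    (hdec : ∀ U ∈ univ.powersetCard t, (if U ∈ X then (1 : ℝ) else 0) = (∑ j ∈ range (t + 1), up^[t - j] (p j)) U)
    (κ : ℕ → ℕ → ℝ)
    (hA : ∀ c ∈ C, ∀ U ∈ univ.powersetCard t, ∀ U' ∈ univ.powersetCard t,
      ∑ M : PMatch n, (if (U.filter fun x => M.2.partner x ∉ U).card = c then (1 : ℝ) else 0) *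
        (if (U'.filter fun x => M.2.partner x ∉ U').card = c then (1 : ℝ) else 0) = κ c (U ∩ U').card)
    (Λ : ℕ → ℝ) (hΛ0 : ∀ c ∈ C, 0 ≤ Λ c) (hΛ : ∀ c ∈ C, ∀ j, D < j → j ≤ t → kernelEigen n t j (κ c) ≤ Λ c) :
    |∑ U : OddSet n, ∑ M ∈ Y, levelWeight n t C w U M * (if U.1 ∈ X then (1 : ℝ) else 0) +
        (Fintype.card (PMatch n) : ℝ)⁻¹ *
          ∑ M ∈ Y, ∑ A : {A : Finset (Fin n) // A.card ≤ D},
            (∑ j ∈ range (t + 1), ((t - j).factorial : ℝ) • (if D < j then 0 else p j)) A.1 *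
              knapsackMoment M.1.card ((t : ℝ) / 2) (M.1.filter fun e => ∃ a ∈ A.1, a ∈ e).card| ≤
      ∑ c ∈ C, |w c| / ((Qset n t c).card : ℝ) * Real.sqrt (Λ c * ((Y.card : ℝ) * X.card)) := by
  classical
  have htodd : Odd t := hdes.1
  have htn : 2 * t ≤ n + 1 := by have := hdes.2.1; omega
  set q : Finset (Fin n) → ℝ := ∑ j ∈ range (t + 1), ((t - j).factorial : ℝ) • (if D < j then 0 else p j) with hq
  obtain ⟨U₀, hU₀⟩ : ∃ U : Finset (Fin n), U ∈ univ.powersetCard t := by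
    have : (univ.powersetCard t : Finset (Finset (Fin n))).Nonempty := by
      apply powersetCard_nonempty.2; rw [card_univ, Fintype.card_fin]; omega
    exact this
  have hq0 : ∀ A : Finset (Fin n), D < A.card → q A = 0 :=
    fun A hA => (lowPart_apply_eq_zeta D p hp (mem_powersetCard.1 hU₀).2).2 A hA
  -- split `1_X = f_{≤D} + f_{>D}` inside the design value (the weight vanishes off the `t`-sets)
  have hsplit : ∀ (U : OddSet n) (M : PMatch n), levelWeight n t C w U M * (if U.1 ∈ X then (1 : ℝ) else 0) =
      levelWeight n t C w U M * zeta q U.1 +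
        levelWeight n t C w U M * (∑ j ∈ range (t + 1), up^[t - j] (if D < j then p j else 0)) U.1 := by
    intro U M
    by_cases hU : U.1.card = t
    · have hUP : U.1 ∈ univ.powersetCard t := mem_powersetCard_univ.2 hU
      rw [hdec U.1 hUP, ladderSum_eq_low_add_high D p, Pi.add_apply, (lowPart_apply_eq_zeta D p hp hU).1, mul_add]
    · have h0 : levelWeight n t C w U M = 0 := by
        rw [levelWeight]
        exact sum_eq_zero fun c _ => by rw [if_neg (fun h => hU (mem_Qset_iff.1 h).1)]
      rw [h0]; ring
  have hsum : ∑ U : OddSet n, ∑ M ∈ Y, levelWeight n t C w U M * (if U.1 ∈ X then (1 : ℝ) else 0) =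
      ∑ U : OddSet n, ∑ M ∈ Y, levelWeight n t C w U M * zeta q U.1 +
        ∑ U : OddSet n, ∑ M ∈ Y, levelWeight n t C w U M *
          (∑ j ∈ range (t + 1), up^[t - j] (if D < j then p j else 0)) U.1 := by
    rw [← sum_add_distrib]
    refine Fintype.sum_congr _ _ fun U => ?_
    rw [← sum_add_distrib]
    exact sum_congr rfl fun M _ => hsplit U M
  -- low part: exact pricing (brick 14); high part: the spectral tail (brick 15)
  have hlow := lowDegree_rectangle_value_eq hdes q hq0 Y
  have hhigh := highPart_rectangle_value_le htodd htn C w p hp κ hA Λ hΛ0 (K := D) hΛ Y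
  -- `Σ_{|U|=t} 1_X(U)² = |X|`
  have hnorm : ∑ U ∈ univ.powersetCard t, (∑ j ∈ range (t + 1), up^[t - j] (p j)) U ^ 2 = (X.card : ℝ) := by
    calc ∑ U ∈ univ.powersetCard t, (∑ j ∈ range (t + 1), up^[t - j] (p j)) U ^ 2
        = ∑ U ∈ univ.powersetCard t, (if U ∈ X then (1 : ℝ) else 0) ^ 2 :=
          sum_congr rfl fun U hU => by rw [← hdec U hU]
      _ = ∑ U ∈ univ.powersetCard t, (if U ∈ X then (1 : ℝ) else 0) :=
          sum_congr rfl fun U _ => by split_ifs <;> simp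
      _ = (((univ.powersetCard t).filter (fun U => U ∈ X)).card : ℝ) := by
          rw [← sum_filter, sum_const, nsmul_eq_mul, mul_one]
      _ = (X.card : ℝ) := by rw [filter_mem_eq_inter, inter_eq_right.2 hX]
  set SX := ∑ U : OddSet n, ∑ M ∈ Y, levelWeight n t C w U M * (if U.1 ∈ X then (1 : ℝ) else 0) with hSX
  set Slow := ∑ U : OddSet n, ∑ M ∈ Y, levelWeight n t C w U M * zeta q U.1 with hSlow
  set Shigh := ∑ U : OddSet n, ∑ M ∈ Y, levelWeight n t C w U M *
    (∑ j ∈ range (t + 1), up^[t - j] (if D < j then p j else 0)) U.1 with hShigh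
  set E := ∑ M ∈ Y, ∑ A : {A : Finset (Fin n) // A.card ≤ D},
    q A.1 * knapsackMoment M.1.card ((t : ℝ) / 2) (M.1.filter fun e => ∃ a ∈ A.1, a ∈ e).card with hE
  have hfin : SX + (Fintype.card (PMatch n) : ℝ)⁻¹ * E = Shigh := by rw [hsum, hlow]; ring
  rw [hfin, ← hnorm]
  exact hhigh

end Summit.PneNP.PneNP.Theorems.ChebyshevTracialDesignRectangleTruncation
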